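/-
Copyright: cell pub-balaban-gaps, seat ne8 (estimate NE7c), gen 18. Project licence.
-/
import Summits.QuantumFields.BalabanUV.T4Continuum.Spine.NE7c.LiveFactorAdaptiveCascade
import Summits.QuantumFields.BalabanUV.T4Continuum.Spine.NE7c.LiveFactorGlobalCompact

/-!
# The member OF RECORD of road (δ) — (δ-global-compact, file 11: ONE threshold assignment `c : ℕ → ℕ` by absolute level for EVERY cutoff) — FIRES on
# ADAPTIVE DECISION TREES under ANY JOINT LAW, with the PER-LEVEL cascade constants `V_j = 2(∏_σ(ν_{j,σ} + 1) − 1)` (file 13's (L2↓) instantiated by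
# real threshold tests): only the WINDOW BOOKKEEPING is left as hypothesis (row NE7c; junction J-28; MODEL, [folklore]) — completes the matrix
# {member (δ-1), member of record} × {fixed battery, adaptive tree} of road (δ)'s MODEL side (files 47 ∕ 50 ∕ 51 ∕ THIS)

Cell `pub-balaban-gaps` (G2), seat ne8, estimate **NE7c** (`T4IndicatorShell.ShellWeightBound`; two-run artefact, NOT PRINTED in [Bałaban 1983–89], NOT
PROVED).  Proof-only file under `Spine/NE7c/`: imports this seat's files 49 `LiveFactorAdaptiveCascade` (`sum_card_shell_le_cascade`, the pointwise cascade for real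
threshold tests) and 11 `LiveFactorGlobalCompact` (`shellWeightBound_of_globalCompact`); through them the tree's `T4ShellMeasure` (`SlotLedger.of_realized`,
`candidateTotals_le_of_pointwise`, `twoSidedShell`).  Mathlib measure theory otherwise.  Nothing of Bałaban's is named; no `def` (paths are bare `Nat.rec`);
classical decidability; 0 `sorry`.

THE QUESTION (file 51 fired the member of record on FIXED per-level batteries; file 50 fired member (δ-1) on ADAPTIVE trees; `ne/NE7c.md` §15∕§16: for the
global member the own-level count (L2↓) is `T4ShellMeasure` §8's cascade RESTRICTED to the stages carrying level-`j` tests, file 13 `LiveFactorGlobalCascade`).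
Does the member of record fire on an ARBITRARY adaptive tree under an ARBITRARY joint law, when ONLY level `j`'s candidate varies in the own-coordinate sums
and the other levels' tests — thresholds FIXED by the global assignment — steer the path as well?

ANSWER ([folklore]).
* §1 `path_restrict_eq` — PATH IDENTIFICATION at a configuration: varying only `c j ↦ m`, the path of the configuration's outcome vector through the FULL tree
  equals the path through the LEVEL-`j` RESTRICTED tree (booked = level-`j` tests against `θ_t(1 − ρ⋆_j)^m`; outcome map = `next` fed with the level-`j` outcomes
  AND the configuration's fixed outcomes of the other levels).
* §2 **`sum_card_levelShell_le_cascade`** — THE PER-LEVEL POINTWISE CASCADE: `Σ_{m<n} Σ_{σ<S} #{t ∈ tests σ (path(c[j↦m]) σ) : lev t = j, y_t ∈ twoSidedShell θ_t ρ⋆_j ρ_t m}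
  + 2 ≤ 2·∏_{σ<S}(ν_σ + 1)`, `ν_σ ≥ #` level-`j` tests booked at stage `σ` (file 49 on the restricted tree + §1).
* §3 `mem_cellAt_iff`, `sum_indicator_level_le_count` (pointwise: only the configuration's own cell contributes), **`levelTotal_le`** — (L2↓) UNDER ANY LAW:
  `Σ_{m<n} Σ_{(σ,t): lev t = j} Σ_ω P(cell_{c[j↦m],ω} ∩ {t booked at σ on path(ω), u_t ∈ shell_t(m)}) ≤ 2·∏_σ(ν_σ+1) − 2` (masses → `lintegral`s → §2 →
  `candidateTotals_le_of_pointwise`); `sum_measureReal_cellAt_eq_one` (partition), `ledger_fields`.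
* §4 **`shellWeightBound_globalAdaptiveTree`** — per comparison `K` each run on ITS OWN probability space with measurable `u^X_{K,t}` (ANY dependence), levels
  `lev^X K t ∈ W K`, radii `2ρ^X ≤ ρ⋆_{lev}`, its own ADAPTIVE tree booking ≤ `ν_{j,σ}` level-`j` tests at stage `σ`: file 11 FIRES with (FD) `D K j = sup_t lev K t + 1`
  (the level-`j` weight sees every level's candidate through the path — finitely many), **(L2↓) `V_j = 2(∏_σ(ν_{j,σ}+1) − 1)`**, `Z_K = 1`, ledgers and cover (fibrewise by
  level) by σ-additivity — `∃ c, (∀ j, c j < n j) ∧ ShellWeightBound …` with `Wsh K` = the two runs' total booked-shell mass at `c`; LEFT as hypotheses file 11's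
  window bookkeeping with `V_j` in the window majorant `Σ_{j∈W K} t_j·(2·#B_j·V_j∕n_j) ≤ C·ϑ^K`.

WHAT THIS SHOWS ∕ DOES NOT SHOW (honest).  SHOWS: for the member OF RECORD on ADAPTIVE trees — as for (δ-1) (file 50) and for fixed batteries (files 47∕51) —
every law-side input is σ-additivity and every tree-side input is the per-stage per-level count; the own-coordinate subtlety of the global member (other levels'
tests steer the path while level `j`'s candidate varies) costs nothing beyond restricting the cascade to level `j` (§1–§2).  DOES NOT SHOW: WHICH tree is Bałaban's
(node O), the window bookkeeping (U1b ∕ (W1) data), (L1-levelwise), two-run closeness.  BY-NAME EFFECT ON THE WALL: none (MODEL).  VERDICT WORD UNCHANGED: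
WORK-bound behind node O; INSTANCE 0∕1.  NE7c ∕ NE7b NOT PRINTED ∕ NOT PROVED; spine 0∕9; one finite T⁴ — NOT ℝ⁴, NOT infinite volume, NOT the mass gap, NOT Clay.
HONEST DEPENDENCY (cell): continuum YM on T⁴ ⇐ BetaPertH ∧ nine spine estimates (0∕9 proved); BetaPertH ⇐ (D1) ∧ (D4) ∧ CAP+tail.
-/

set_option autoImplicit false

noncomputable section

open MeasureTheory Finset Set
open scoped Classical ENNReal
open Literature.MathematicalPhysics.QuantumFieldTheory.Balaban1983to89
open Literature.MathematicalPhysics.QuantumFieldTheory.Balaban1983to89.T4ShellMeasure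
open Summit.QuantumFields.BalabanUV.T4Continuum.Spine.NE7c.LiveFactorAdaptiveCascade (sum_card_shell_le_cascade)
open Summit.QuantumFields.BalabanUV.T4Continuum.Spine.NE7c.LiveFactorGlobalCompact (shellWeightBound_of_globalCompact)

namespace Summit.QuantumFields.BalabanUV.T4Continuum.Spine.NE7c.LiveFactorGlobalAdaptiveModel

/-! ## §1 The LEVEL-`j` RESTRICTION of an adaptive tree at a configuration: only the level-`j` tests are booked against the varying candidate; the other
levels' tests, whose thresholds the global assignment FIXES, are decided by the configuration and folded into the outcome maps -/

section Restrict

variable {α τ : Type*} (tests : ℕ → α → Finset τ) (next : ℕ → α → Finset τ → α) (a₀ : α) (lev : τ → ℕ) (y θ : τ → ℝ) (ρs : ℕ → ℝ)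
  (c : ℕ → ℕ) (j : ℕ)

/-- **PATH IDENTIFICATION.**  Varying ONLY level `j`'s candidate `m` in the global assignment `c` (`Function.update c j m`), the path of the configuration's
outcome vector through the FULL tree equals the path, through the level-`j` RESTRICTED tree (booked tests = the level-`j` tests; outcome map = `next` fed with
the level-`j` outcomes AND the configuration's fixed outcomes of the other levels' tests), of the outcome vector of the level-`j` tests against `θ_t(1 − ρ⋆_j)^m`.
[folklore] -/
theorem path_restrict_eq (m : ℕ) : ∀ σ : ℕ, Nat.rec (motive := fun _ => α) a₀ (fun σ a => next σ a ((((tests σ a).filter fun t => lev t = j).filter fun t => decide (y t < θ t * (1 - ρs j) ^ m) = true) ∪ (tests σ a).filter fun t => lev t ≠ j ∧ y t < θ t * (1 - ρs (lev t)) ^ c (lev t))) σ = Nat.rec (motive := fun _ => α) a₀ (fun σ a => next σ a ((tests σ a).filter fun t =>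
      decide (y t < θ t * (1 - ρs (lev t)) ^ Function.update c j m (lev t)) = true)) σ
  | 0 => rfl
  | σ + 1 => by
    have ih := path_restrict_eq m σ
    show next σ _ (_ ∪ _) = next σ _ _
    rw [ih]
    congr 1
    ext t
    simp only [Finset.mem_union, Finset.mem_filter, decide_eq_true_eq]
    by_cases h : lev t = j
    · rw [h, Function.update_self]
      constructor
      · rintro (⟨⟨ht, -⟩, hlt⟩ | ⟨-, hne, -⟩)
        · exact ⟨ht, hlt⟩
        · exact (hne rfl).elim
      · rintro ⟨ht, hlt⟩; exact Or.inl ⟨⟨ht, rfl⟩, hlt⟩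
    · rw [Function.update_of_ne h]
      constructor
      · rintro (⟨⟨-, hj⟩, -⟩ | ⟨ht, -, hlt⟩)
        · exact absurd hj h
        · exact ⟨ht, hlt⟩
      · rintro ⟨ht, hlt⟩; exact Or.inr ⟨ht, h, hlt⟩

variable [DecidableEq α] (ρ : τ → ℝ)

/-- **THE PER-LEVEL POINTWISE CASCADE.**  At ONE configuration (values `y_t`), for a global assignment `c` with ONLY level `j`'s candidate `m` varying over `m < n`:
the level-`j` booked tests found in their two-sided shells (spacing `ρ⋆_j`) along the ACTUAL path of the full tree, summed over `m` and the stages, number at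
most `2(∏_σ(ν_σ + 1) − 1)`, `ν_σ` = a bound on the level-`j` tests booked per stage — file 49's `sum_card_shell_le_cascade` for the level-`j` RESTRICTED tree +
`path_restrict_eq` (file 13's per-level count (L2↓) instantiated by real threshold tests). [folklore] -/
theorem sum_card_levelShell_le_cascade (ν : ℕ → ℕ) (hν : ∀ σ a, ((tests σ a).filter fun t => lev t = j).card ≤ ν σ) (hθ : ∀ t, 0 ≤ θ t) (h0 : ∀ t, 0 ≤ ρ t) (hle : ∀ t, lev t = j → ρ t ≤ ρs j) (hs0 : 0 ≤ ρs j) (hs1 : ρs j ≤ 1) (n S : ℕ) : (∑ m ∈ range n, ∑ σ ∈ range S, ((tests σ (Nat.rec (motive := fun _ => α) a₀ (fun σ a => next σ a ((tests σ a).filter fun t =>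
        decide (y t < θ t * (1 - ρs (lev t)) ^ Function.update c j m (lev t)) = true)) σ)).filter fun t =>
          lev t = j ∧ y t ∈ twoSidedShell (θ t) (ρs j) (ρ t) m).card) + 2 ≤ 2 * ∏ σ ∈ range S, (ν σ + 1) := by
  have h49 := sum_card_shell_le_cascade (fun σ a => (tests σ a).filter fun t => lev t = j)
    (fun σ a T => next σ a (T ∪ (tests σ a).filter fun t => lev t ≠ j ∧ y t < θ t * (1 - ρs (lev t)) ^ c (lev t))) a₀ ν (fun σ a => hν σ a) y θ
    (fun t => if lev t = j then ρ t else 0) hθ (fun t => by by_cases h : lev t = j <;> simp only [h, if_true, if_false, le_refl, h0])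
    (fun t => by
      by_cases h : lev t = j
      · simp only [h, if_true]; exact hle t h
      · simp only [h, if_false]; exact hs0) hs0 hs1 n S
  refine le_trans (le_of_eq ?_) h49
  congr 1
  refine sum_congr rfl fun m _ => sum_congr rfl fun σ _ => ?_
  rw [path_restrict_eq tests next a₀ lev y θ ρs c j m σ, Finset.filter_filter]
  congr 1
  refine Finset.filter_congr fun t _ => ?_
  by_cases h : lev t = j
  · simp only [h, if_true, true_and]
  · simp only [h, false_and, if_false]

end Restrict


/-! ## §3 Cells at the assignment's thresholds and the per-level measure lift -/

section Level

variable {Ω α τ : Type*} {S : ℕ} (u : τ → Ω → ℝ) (θ ρ : τ → ℝ) (ρs : ℕ → ℝ) (lev : τ → ℕ)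
  (tests : ℕ → α → Finset τ) (next : ℕ → α → Finset τ → α) (a₀ : α) (c : ℕ → ℕ) (j : ℕ)

/-- A configuration lies in the cell of `ω` (thresholds of the assignment) iff `ω` is its outcome vector. [folklore] -/
theorem mem_cellAt_iff (c' : ℕ → ℕ) (ω : τ → Bool) (x : Ω) : x ∈ (⋂ t, (u t) ⁻¹' (if ω t then Iio (θ t * (1 - ρs (lev t)) ^ c' (lev t)) else Ici (θ t * (1 - ρs (lev t)) ^ c' (lev t)))) ↔ ω = fun t => decide (u t x < θ t * (1 - ρs (lev t)) ^ c' (lev t)) := by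
  rw [Set.mem_iInter, funext_iff]; refine forall_congr' fun t => ?_; rw [Set.mem_preimage]; cases hω : ω t
  · simp only [Bool.false_eq_true, if_false, Set.mem_Ici]; rw [eq_comm, decide_eq_false_iff_not, not_lt]
  · simp only [if_true, Set.mem_Iio]; rw [eq_comm, decide_eq_true_iff]

variable [Fintype τ] [DecidableEq τ]

/-- POINTWISE, LEVEL `j`, candidate `m` of level `j` (others frozen at `c`): summed over the cells and the level-`j` slots `(σ, t)`, the indicators of «`x ∈ cell_ω`,
`t` booked at `σ` on the path of `ω`, `u_t(x)` in its shell» are at most the number of level-`j` booked tests of `x`'s OWN path found in their shells. [folklore] -/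
theorem sum_indicator_level_le_count (m : ℕ) (x : Ω) : ∑ p ∈ (univ : Finset (Fin S × τ)).filter (fun p => lev p.2 = j), ∑ ω : τ → Bool, ((⋂ t, (u t) ⁻¹' (if ω t then Iio (θ t * (1 - ρs (lev t)) ^ (Function.update c j m) (lev t)) else Ici (θ t * (1 - ρs (lev t)) ^ (Function.update c j m) (lev t)))) ∩ {x | p.2 ∈ tests p.1 (Nat.rec (motive := fun _ => α) a₀ (fun σ a => next σ a
            ((tests σ a).filter fun t => ω t = true)) p.1) ∧ u p.2 x ∈ twoSidedShell (θ p.2) (ρs (lev p.2)) (ρ p.2) ((Function.update c j m) (lev p.2))}).indicator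
            (1 : Ω → ℝ≥0∞) x ≤ ((∑ σ ∈ range S, ((tests σ (Nat.rec (motive := fun _ => α) a₀ (fun σ a => next σ a ((tests σ a).filter fun t => decide (u t x < θ t * (1 - ρs
            (lev t)) ^ (Function.update c j m) (lev t)) = true)) σ)).filter fun t => lev t = j ∧ u t x ∈ twoSidedShell (θ t) (ρs j) (ρ t) m).card : ℕ) : ℝ≥0∞) := by
  rw [Finset.sum_comm, Finset.sum_eq_single (fun t => decide (u t x < θ t * (1 - ρs (lev t)) ^ (Function.update c j m) (lev t)))]
  · calc ∑ p ∈ (univ : Finset (Fin S × τ)).filter (fun p => lev p.2 = j), ((⋂ t, (u t) ⁻¹' (if decide (u t x < θ t * (1 - ρs (lev t)) ^ (Function.update c j m) (lev t)) then Iio (θ t * (1 - ρs (lev t)) ^ (Function.update c j m) (lev t)) else Ici (θ t * (1 - ρs (lev t)) ^ (Function.update c j m) (lev t)))) ∩ {z | p.2 ∈ tests p.1 (Nat.rec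
          (motive := fun _ => α) a₀ (fun σ a => next σ a ((tests σ a).filter fun t => decide (u t x < θ t * (1 - ρs (lev t)) ^ (Function.update c j m) (lev t)) = true)) p.1) ∧
          u p.2 z ∈ twoSidedShell (θ p.2) (ρs (lev p.2)) (ρ p.2) ((Function.update c j m) (lev p.2))}).indicator (1 : Ω → ℝ≥0∞) x
        ≤ ∑ p ∈ (univ : Finset (Fin S × τ)).filter (fun p => lev p.2 = j), (if p.2 ∈ tests p.1 (Nat.rec (motive := fun _ => α) a₀ (fun σ a => next σ a ((tests σ a).filter fun t =>
            decide (u t x < θ t * (1 - ρs (lev t)) ^ (Function.update c j m) (lev t)) = true)) p.1) then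
            (if u p.2 x ∈ twoSidedShell (θ p.2) (ρs (lev p.2)) (ρ p.2) ((Function.update c j m) (lev p.2)) then (1 : ℝ≥0∞) else 0) else 0) := by
          refine sum_le_sum fun p _ => ?_
          refine (Set.indicator_le_indicator_of_subset Set.inter_subset_right (fun _ => zero_le_one) x).trans_eq ?_
          simp only [Set.indicator_apply, Set.mem_setOf_eq, ite_and]
      _ = ∑ σ : Fin S, ((((tests σ (Nat.rec (motive := fun _ => α) a₀ (fun σ a => next σ a ((tests σ a).filter fun t => decide (u t x < θ t * (1 - ρs (lev t)) ^ (Function.update c j m) (lev t)) = true)) σ)).filter fun t => lev t = j ∧ u t x ∈ twoSidedShell (θ t) (ρs j) (ρ t) m).card : ℕ) : ℝ≥0∞) := by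
          rw [Finset.sum_filter, Fintype.sum_prod_type]
          refine sum_congr rfl fun σ _ => ?_
          dsimp only
          rw [Finset.natCast_card_filter]
          symm
          calc (∑ t ∈ tests σ (Nat.rec (motive := fun _ => α) a₀ (fun σ a => next σ a ((tests σ a).filter fun t => decide (u t x < θ t * (1 - ρs (lev t)) ^ (Function.update c j m) (lev t)) = true)) σ), if lev t = j ∧ u t x ∈ twoSidedShell (θ t) (ρs j) (ρ t) m then (1 : ℝ≥0∞) else 0)
              = ∑ t ∈ tests σ (Nat.rec (motive := fun _ => α) a₀ (fun σ a => next σ a ((tests σ a).filter fun t => decide (u t x < θ t * (1 - ρs (lev t)) ^ (Function.update c j m) (lev t)) = true)) σ), (if lev t = j then (if t ∈ tests σ (Nat.rec (motive := fun _ => α) a₀ (fun σ a => next σ a ((tests σ a).filter fun t => decide (u t x < θ t * (1 - ρs (lev t)) ^ (Function.update c j m) (lev t)) = true)) σ) then (if u t x ∈ twoSidedShell (θ t) (ρs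
                      (lev t)) (ρ t) ((Function.update c j m) (lev t)) then (1 : ℝ≥0∞) else 0) else 0) else 0) :=
                sum_congr rfl fun t ht => by
                  by_cases h : lev t = j
                  · simp only [h, ht, Function.update_self, if_true, true_and]
                  · simp only [h, false_and, if_false]
            _ = ∑ t, (if lev t = j then (if t ∈ tests σ (Nat.rec (motive := fun _ => α) a₀ (fun σ a => next σ a ((tests σ a).filter fun t => decide (u t x < θ t * (1 - ρs (lev t)) ^ (Function.update c j m) (lev t)) = true)) σ) then (if u t x ∈ twoSidedShell (θ t) (ρs (lev t)) (ρ t) ((Function.update c j m) (lev t)) then (1 : ℝ≥0∞) else 0) else 0) else 0) :=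
                Finset.sum_subset (Finset.subset_univ _) fun t _ ht => by simp only [ht, if_false, ite_self]
      _ = ((∑ σ ∈ range S, ((tests σ (Nat.rec (motive := fun _ => α) a₀ (fun σ a => next σ a ((tests σ a).filter fun t => decide (u t x < θ t * (1 - ρs (lev t)) ^ (Function.update c j m) (lev t)) = true)) σ)).filter fun t => lev t = j ∧ u t x ∈ twoSidedShell (θ t) (ρs j) (ρ t) m).card : ℕ) : ℝ≥0∞) := by
          rw [Nat.cast_sum, ← Fin.sum_univ_eq_sum_range]
  · intro ω _ hne
    refine Finset.sum_eq_zero fun p _ => ?_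
    rw [Set.indicator_of_notMem]
    intro hx
    exact hne ((mem_cellAt_iff u θ ρs lev _ ω x).1 hx.1)
  · intro h; exact absurd (Finset.mem_univ _) h

variable [MeasurableSpace Ω] [DecidableEq α] (P : Measure Ω) [IsProbabilityMeasure P]

/-- **THE OWN-LEVEL CANDIDATE SUMS (L2↓) OF AN ADAPTIVE TREE UNDER ANY LAW**: with the global assignment frozen off level `j` and level `j`'s candidate `m`
ranging over `m < n`, the level-`j` booked-shell masses `Σ_{(σ,t) : lev t = j} Σ_ω P(cell_{c[j↦m],ω} ∩ {t booked at σ on path(ω), u_t ∈ shell_t(m)})` sum over `m` to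
at most `2·∏_{σ<S}(ν_σ + 1) − 2`, `ν_σ` = a bound on the level-`j` tests booked per stage (the per-level pointwise cascade integrated; measurable `u_t`,
`θ_t ≥ 0`, `0 ≤ ρ_t`, `ρ_t ≤ ρ⋆_j` at level `j`, `0 ≤ ρ⋆_j ≤ 1`). [folklore] -/
theorem levelTotal_le (hu : ∀ t, Measurable (u t)) (hθ : ∀ t, 0 ≤ θ t) (h0 : ∀ t, 0 ≤ ρ t) (hle : ∀ t, lev t = j → ρ t ≤ ρs j) (hs0 : 0 ≤ ρs j) (hs1 : ρs j ≤ 1) (ν : ℕ → ℕ) (hν : ∀ σ a, ((tests σ a).filter fun t => lev t = j).card ≤ ν σ) (n : ℕ) : ∑ m ∈ range n, ∑ p ∈ (univ : Finset (Fin S × τ)).filter (fun p => lev p.2 = j), ∑ ω : τ → Bool, P.real ((⋂ t, (u t) ⁻¹' (if ω t then Iio (θ t * (1 - ρs (lev t)) ^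
        (Function.update c j m) (lev t)) else Ici (θ t * (1 - ρs (lev t)) ^ (Function.update c j m) (lev t)))) ∩ {x | p.2 ∈ tests p.1 (Nat.rec (motive := fun _ => α) a₀ (fun σ a => next σ a ((tests σ a).filter fun t => ω t = true)) p.1) ∧ u p.2 x ∈ twoSidedShell (θ p.2) (ρs (lev p.2)) (ρ p.2) ((Function.update c j m) (lev p.2))}) ≤ ((2 * ∏ σ ∈ range S, (ν σ + 1) - 2 : ℕ) : ℝ) := by
  have hmeas : ∀ (m : ℕ) (p : Fin S × τ) (ω : τ → Bool), MeasurableSet ((⋂ t, (u t) ⁻¹' (if ω t then Iio (θ t * (1 - ρs (lev t)) ^ (Function.update c j m) (lev t)) else Ici (θ t * (1 - ρs (lev t)) ^ (Function.update c j m) (lev t)))) ∩ {x | p.2 ∈ tests p.1 (Nat.rec (motive := fun _ => α) a₀ (fun σ a => next σ a ((tests σ a).filter fun t =>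
          ω t = true)) p.1) ∧ u p.2 x ∈ twoSidedShell (θ p.2) (ρs (lev p.2)) (ρ p.2) ((Function.update c j m) (lev p.2))}) := by
    intro m p ω
    refine (MeasurableSet.iInter fun t => hu t (by split <;> [exact measurableSet_Iio; exact measurableSet_Ici])).inter ?_
    rw [Set.setOf_and]
    exact (MeasurableSet.const _).inter ((hu p.2) measurableSet_Ico)
  have h := candidateTotals_le_of_pointwise P (n := n)
    (fun m => ∑ p ∈ (univ : Finset (Fin S × τ)).filter (fun p => lev p.2 = j), ∑ ω : τ → Bool, P.real ((⋂ t, (u t) ⁻¹' (if ω t then Iio (θ t * (1 - ρs (lev t)) ^ (Function.update c j m) (lev t)) else Ici (θ t * (1 - ρs (lev t)) ^ (Function.update c j m) (lev t)))) ∩ {x | p.2 ∈ tests p.1 (Nat.rec (motive := fun _ => α) a₀ (fun σ a => next σ a ((tests σ a).filter fun t => ω t = true)) p.1) ∧ u p.2 x ∈ twoSidedShell (θ p.2) (ρs (lev p.2)) (ρ p.2) ((Function.update c j m) (lev p.2))}))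
    (fun m x => ((∑ σ ∈ range S, ((tests σ (Nat.rec (motive := fun _ => α) a₀ (fun σ a => next σ a ((tests σ a).filter fun t => decide (u t x < θ t * (1 - ρs (lev t)) ^ (Function.update c j m) (lev t)) = true)) σ)).filter fun t => lev t = j ∧ u t x ∈ twoSidedShell (θ t) (ρs j) (ρ t) m).card : ℕ) : ℝ≥0∞)) ((2 * ∏ σ ∈ range S, (ν σ + 1) - 2 : ℕ) : NNReal) ?_ ?_
  · simpa only [measure_univ, ENNReal.toReal_one, mul_one, NNReal.coe_natCast] using h
  · intro x
    have hc := sum_card_levelShell_le_cascade tests next a₀ lev (fun t => u t x) θ ρs c j ρ ν hν hθ h0 hle hs0 hs1 n S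
    have hc' : ∑ m ∈ range n, ∑ σ ∈ range S, ((tests σ (Nat.rec (motive := fun _ => α) a₀ (fun σ a => next σ a ((tests σ a).filter fun t => decide (u t x < θ t * (1 - ρs (lev t)) ^ (Function.update c j m) (lev t)) = true)) σ)).filter fun t => lev t = j ∧ u t x ∈ twoSidedShell (θ t) (ρs j) (ρ t) m).card ≤ 2 * ∏ σ ∈ range S, (ν σ + 1) - 2 := by omega
    rw [← Nat.cast_sum, ENNReal.coe_natCast]
    exact_mod_cast hc'
  · intro m _
    have hbd : ∀ x, ((∑ σ ∈ range S, ((tests σ (Nat.rec (motive := fun _ => α) a₀ (fun σ a => next σ a ((tests σ a).filter fun t => decide (u t x < θ t * (1 - ρs (lev t)) ^ (Function.update c j m) (lev t)) = true)) σ)).filter fun t => lev t = j ∧ u t x ∈ twoSidedShell (θ t) (ρs j) (ρ t) m).card : ℕ) : ℝ≥0∞) ≤ ((∑ σ ∈ range S, ν σ : ℕ) : ℝ≥0∞) := by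
      intro x
      have hnat : ∑ σ ∈ range S, ((tests σ (Nat.rec (motive := fun _ => α) a₀ (fun σ a => next σ a ((tests σ a).filter fun t => decide (u t x < θ t * (1 - ρs (lev t)) ^ (Function.update c j m) (lev t)) = true)) σ)).filter fun t => lev t = j ∧ u t x ∈ twoSidedShell (θ t) (ρs j) (ρ t) m).card ≤ ∑ σ ∈ range S, ν σ :=
        Finset.sum_le_sum fun σ _ => by
          calc ((tests σ (Nat.rec (motive := fun _ => α) a₀ (fun σ a => next σ a ((tests σ a).filter fun t => decide (u t x < θ t * (1 - ρs (lev t)) ^ (Function.update c j m) (lev t)) = true)) σ)).filter fun t => lev t = j ∧ u t x ∈ twoSidedShell (θ t) (ρs j) (ρ t) m).card ≤ ((tests σ (Nat.rec (motive := fun _ => α) a₀ (fun σ a => next σ a ((tests σ a).filter fun t => decide (u t x < θ t * (1 - ρs (lev t)) ^ (Function.update c j m) (lev t)) = true)) σ)).filter fun t => lev t = j).card :=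
                card_le_card fun t ht => by rw [Finset.mem_filter] at ht ⊢; exact ⟨ht.1, ht.2.1⟩
            _ ≤ ν σ := hν σ _
      exact_mod_cast hnat
    have hfin : ∫⁻ x, ((∑ σ ∈ range S, ((tests σ (Nat.rec (motive := fun _ => α) a₀ (fun σ a => next σ a ((tests σ a).filter fun t => decide (u t x < θ t * (1 - ρs (lev t)) ^ (Function.update c j m) (lev t)) = true)) σ)).filter fun t => lev t = j ∧ u t x ∈ twoSidedShell (θ t) (ρs j) (ρ t) m).card : ℕ) : ℝ≥0∞) ∂P ≠ ∞ := by
      refine ne_top_of_le_ne_top ?_ (lintegral_mono hbd)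
      rw [lintegral_const, measure_univ, mul_one]; exact ENNReal.natCast_ne_top _
    have hsum : (∑ p ∈ (univ : Finset (Fin S × τ)).filter (fun p => lev p.2 = j), ∑ ω : τ → Bool, P ((⋂ t, (u t) ⁻¹' (if ω t then Iio (θ t * (1 - ρs (lev t)) ^ (Function.update c j m) (lev t)) else Ici (θ t * (1 - ρs (lev t)) ^ (Function.update c j m) (lev t)))) ∩ {x | p.2 ∈ tests p.1 (Nat.rec (motive := fun _ => α) a₀ (fun σ a => next σ a ((tests σ a).filter fun t => ω t = true)) p.1) ∧ u p.2 x ∈ twoSidedShell (θ p.2) (ρs (lev p.2)) (ρ p.2) ((Function.update c j m)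
            (lev p.2))})).toReal = ∑ p ∈ (univ : Finset (Fin S × τ)).filter (fun p => lev p.2 = j), ∑ ω : τ → Bool, P.real ((⋂ t, (u t) ⁻¹' (if ω t then Iio (θ t * (1 - ρs
            (lev t)) ^ (Function.update c j m) (lev t)) else Ici (θ t * (1 - ρs (lev t)) ^ (Function.update c j m) (lev t)))) ∩ {x | p.2 ∈ tests p.1 (Nat.rec (motive := fun _ =>
            α) a₀ (fun σ a => next σ a ((tests σ a).filter fun t => ω t = true)) p.1) ∧ u p.2 x ∈ twoSidedShell (θ p.2) (ρs (lev p.2)) (ρ p.2) ((Function.update c j m)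
            (lev p.2))}) := by
      rw [ENNReal.toReal_sum (fun p _ => ENNReal.sum_ne_top.2 fun ω _ => measure_ne_top P _)]
      refine sum_congr rfl fun p _ => ?_
      rw [ENNReal.toReal_sum (fun ω _ => measure_ne_top P _)]
      rfl
    rw [← hsum]
    refine ENNReal.toReal_mono hfin ?_
    calc ∑ p ∈ (univ : Finset (Fin S × τ)).filter (fun p => lev p.2 = j), ∑ ω : τ → Bool, P ((⋂ t, (u t) ⁻¹' (if ω t then Iio (θ t * (1 - ρs (lev t)) ^ (Function.update c j m) (lev t)) else Ici (θ t * (1 - ρs (lev t)) ^ (Function.update c j m) (lev t)))) ∩ {x | p.2 ∈ tests p.1 (Nat.rec (motive := fun _ => α) a₀ (fun σ a => next σ a ((tests σ a).filter fun t => ω t = true)) p.1) ∧ u p.2 x ∈ twoSidedShell (θ p.2) (ρs (lev p.2)) (ρ p.2) ((Function.update c j m) (lev p.2))})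
        = ∑ p ∈ (univ : Finset (Fin S × τ)).filter (fun p => lev p.2 = j), ∑ ω : τ → Bool, ∫⁻ x, (((⋂ t, (u t) ⁻¹' (if ω t then Iio (θ t * (1 - ρs (lev t)) ^ (Function.update c j m) (lev t)) else Ici (θ t * (1 - ρs (lev t)) ^ (Function.update c j m) (lev t)))) ∩ {x | p.2 ∈ tests p.1 (Nat.rec (motive := fun _ => α) a₀ (fun σ a => next σ a ((tests σ a).filter fun t => ω t = true)) p.1) ∧ u p.2 x ∈ twoSidedShell (θ p.2) (ρs (lev p.2)) (ρ p.2) ((Function.update c j m)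
                (lev p.2))})).indicator (1 : Ω → ℝ≥0∞) x ∂P := by
          simp only [lintegral_indicator_one (hmeas m _ _)]
      _ = ∫⁻ x, ∑ p ∈ (univ : Finset (Fin S × τ)).filter (fun p => lev p.2 = j), ∑ ω : τ → Bool, (((⋂ t, (u t) ⁻¹' (if ω t then Iio (θ t * (1 - ρs (lev t)) ^ (Function.update c j m) (lev t)) else Ici (θ t * (1 - ρs (lev t)) ^ (Function.update c j m) (lev t)))) ∩ {x | p.2 ∈ tests p.1 (Nat.rec (motive := fun _ => α) a₀ (fun σ a => next σ a ((tests σ a).filter fun t => ω t = true)) p.1) ∧ u p.2 x ∈ twoSidedShell (θ p.2) (ρs (lev p.2)) (ρ p.2) ((Function.update c j m)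
              (lev p.2))})).indicator (1 : Ω → ℝ≥0∞) x ∂P := by
          rw [lintegral_finsetSum _ fun p _ => Finset.measurable_sum _ fun ω _ => (measurable_one.indicator (hmeas m p ω))]
          refine sum_congr rfl fun p _ => ?_
          rw [lintegral_finsetSum _ fun ω _ => measurable_one.indicator (hmeas m p ω)]
      _ ≤ ∫⁻ x, ((∑ σ ∈ range S, ((tests σ (Nat.rec (motive := fun _ => α) a₀ (fun σ a => next σ a ((tests σ a).filter fun t => decide (u t x < θ t * (1 - ρs (lev t)) ^ (Function.update c j m) (lev t)) = true)) σ)).filter fun t => lev t = j ∧ u t x ∈ twoSidedShell (θ t) (ρs j) (ρ t) m).card : ℕ) : ℝ≥0∞) ∂P := lintegral_mono fun x =>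
              sum_indicator_level_le_count u θ ρ ρs lev tests next a₀ c j m x

/-- the cells at the assignment's thresholds carry total mass `1` (partition). [folklore] -/
theorem sum_measureReal_cellAt_eq_one (hu : ∀ t, Measurable (u t)) (c' : ℕ → ℕ) : ∑ ω : τ → Bool, P.real (⋂ t, (u t) ⁻¹' (if ω t then Iio (θ t * (1 - ρs (lev t)) ^ c' (lev t)) else Ici (θ t * (1 - ρs (lev t)) ^ c' (lev t)))) = 1 := by
  have hcellm : ∀ (ω : τ → Bool), MeasurableSet (⋂ t, (u t) ⁻¹' (if ω t then Iio (θ t * (1 - ρs (lev t)) ^ c' (lev t)) else Ici (θ t * (1 - ρs (lev t)) ^ c' (lev t)))) := fun ω =>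
    MeasurableSet.iInter fun t => hu t (by split <;> [exact measurableSet_Iio; exact measurableSet_Ici])
  have hU : (⋃ ω : τ → Bool, (⋂ t, (u t) ⁻¹' (if ω t then Iio (θ t * (1 - ρs (lev t)) ^ c' (lev t)) else Ici (θ t * (1 - ρs (lev t)) ^ c' (lev t))))) = univ :=
    Set.eq_univ_of_forall fun x => Set.mem_iUnion.2 ⟨_, (mem_cellAt_iff u θ ρs lev c' _ x).2 rfl⟩
  have hdisj : Pairwise (Function.onFun Disjoint fun ω : τ → Bool => (⋂ t, (u t) ⁻¹' (if ω t then Iio (θ t * (1 - ρs (lev t)) ^ c' (lev t)) else Ici (θ t * (1 - ρs (lev t)) ^ c' (lev t))))) := by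
    intro ω ω' hne
    change Disjoint (⋂ t, (u t) ⁻¹' (if ω t then Iio (θ t * (1 - ρs (lev t)) ^ c' (lev t)) else Ici (θ t * (1 - ρs (lev t)) ^ c' (lev t)))) (⋂ t, (u t) ⁻¹' (if ω' t then Iio (θ t * (1 - ρs (lev t)) ^ c' (lev t)) else Ici (θ t * (1 - ρs (lev t)) ^ c' (lev t))))
    rw [Set.disjoint_left]
    intro x hx hx'
    exact hne (((mem_cellAt_iff u θ ρs lev c' ω x).1 hx).trans ((mem_cellAt_iff u θ ρs lev c' ω' x).1 hx').symm)
  rw [← measureReal_iUnion_fintype hdisj hcellm, hU, probReal_univ]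

omit [DecidableEq α] in
/-- **THE REALIZED LEDGER OF THE ADAPTIVE MODEL AT A GLOBAL ASSIGNMENT** (`SlotLedger.of_realized`, tilt `0`; ONE comparison's data): terms = cells at the
assignment's thresholds, slot `(σ, t)`'s piece = the cell's mass on «`t` booked at `σ` on the path of the cell's outcome vector and `u_t` in its shell at its
level's candidate», shell part = the mass on «some booked test in its shell». [folklore] -/
theorem ledger_fields (hu : ∀ t, Measurable (u t)) : (∀ (ω : τ → Bool), 0 ≤ P.real ((⋂ t, (u t) ⁻¹' (if ω t then Iio (θ t * (1 - ρs (lev t)) ^ c (lev t)) else Ici (θ t * (1 - ρs (lev t)) ^ c (lev t)))) ∩ ⋃ p : Fin S × τ, {x | p.2 ∈ tests p.1 (Nat.rec (motive := fun _ => α) a₀ (fun σ a => next σ a ((tests σ a).filter fun t => ω t = true)) p.1) ∧ u p.2 x ∈ twoSidedShell (θ p.2) (ρs (lev p.2)) (ρ p.2) (c (lev p.2))})) ∧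
    (∀ (ω : τ → Bool), P.real ((⋂ t, (u t) ⁻¹' (if ω t then Iio (θ t * (1 - ρs (lev t)) ^ c (lev t)) else Ici (θ t * (1 - ρs (lev t)) ^ c (lev t)))) ∩ ⋃ p : Fin S × τ, {x | p.2 ∈ tests p.1 (Nat.rec (motive := fun _ => α) a₀ (fun σ a => next σ a ((tests σ a).filter fun t => ω t = true)) p.1) ∧ u p.2 x ∈ twoSidedShell (θ p.2) (ρs (lev p.2)) (ρ p.2) (c (lev p.2))}) ≤ P.real (⋂ t, (u t) ⁻¹' (if ω t then Iio (θ t * (1 - ρs (lev t)) ^ c (lev t)) else Ici (θ t * (1 - ρs (lev t)) ^ c (lev t))))) ∧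
    (∀ (ω : τ → Bool), P.real ((⋂ t, (u t) ⁻¹' (if ω t then Iio (θ t * (1 - ρs (lev t)) ^ c (lev t)) else Ici (θ t * (1 - ρs (lev t)) ^ c (lev t)))) ∩ ⋃ p : Fin S × τ, {x | p.2 ∈ tests p.1 (Nat.rec (motive := fun _ => α) a₀ (fun σ a => next σ a ((tests σ a).filter fun t => ω t = true)) p.1) ∧ u p.2 x ∈ twoSidedShell (θ p.2) (ρs (lev p.2)) (ρ p.2) (c (lev p.2))}) ≤ ∑ p : Fin S × τ, P.real ((⋂ t, (u t) ⁻¹' (if ω t then Iio (θ t * (1 - ρs (lev t)) ^ c (lev t)) else Ici (θ t * (1 - ρs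
            (lev t)) ^ c (lev t)))) ∩ {x | p.2 ∈ tests p.1 (Nat.rec (motive := fun _ => α) a₀ (fun σ a => next σ a ((tests σ a).filter fun t => ω t = true)) p.1) ∧
            u p.2 x ∈ twoSidedShell (θ p.2) (ρs (lev p.2)) (ρ p.2) (c (lev p.2))})) ∧
    0 < ∑ ω : τ → Bool, P.real (⋂ t, (u t) ⁻¹' (if ω t then Iio (θ t * (1 - ρs (lev t)) ^ c (lev t)) else Ici (θ t * (1 - ρs (lev t)) ^ c (lev t)))) := by
  refine ⟨fun ω => measureReal_nonneg, fun ω => measureReal_mono Set.inter_subset_left, fun ω => ?_, ?_⟩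
  · rw [Set.inter_iUnion]; exact measureReal_iUnion_fintype_le _
  · rw [sum_measureReal_cellAt_eq_one u θ ρs lev P hu c]; exact one_pos

end Level

/-! ## §4 THE MEMBER OF RECORD FIRES ON ADAPTIVE DECISION TREES UNDER ANY JOINT LAW — per-level cascade constants `V_j = 2(∏_σ(ν_{j,σ} + 1) − 1)` -/

section Main

variable {α τ : Type*} [DecidableEq α] [Fintype τ] [DecidableEq τ] {S : ℕ}
  {ΩA ΩB : ℕ → Type*} [∀ K, MeasurableSpace (ΩA K)] [∀ K, MeasurableSpace (ΩB K)]
  (PA : ∀ K, Measure (ΩA K)) (PB : ∀ K, Measure (ΩB K)) [∀ K, IsProbabilityMeasure (PA K)] [∀ K, IsProbabilityMeasure (PB K)]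
  (uA : ∀ K, τ → ΩA K → ℝ) (uB : ∀ K, τ → ΩB K → ℝ) (θ ρA ρB : ℕ → τ → ℝ) (ρs : ℕ → ℝ) (levA levB : ℕ → τ → ℕ)
  (testsA testsB : ℕ → ℕ → α → Finset τ) (nextA nextB : ℕ → ℕ → α → Finset τ → α) (aA aB : ℕ → α) (ν : ℕ → ℕ → ℕ)

/-- **THE MEMBER OF RECORD (δ-global-compact) FIRES ON ADAPTIVE DECISION TREES UNDER ANY JOINT LAW.**  Per comparison `K`, run `X` lives on ITS OWN probability
space, with measurable observables `u^X_{K,t}` (finite label set `τ`, ANY dependence), levels `lev^X K t ∈ W K`, thresholds `θ_{K,t} ≥ 0`, radii `0 ≤ ρ^X_{K,t}`,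
`2ρ^X_{K,t} ≤ ρ⋆_{lev}` (`0 ≤ ρ⋆_j ≤ 1`), and its own ADAPTIVE tree (`tests^X_K`, `next^X_K`, dead prefix `a^X_K`) booking at stage `σ` at most `ν_{j,σ}` tests of
level `j` (any history-dependence); a GLOBAL assignment `c` gives level `j` the factor `(1 − ρ⋆_j)^{c j}` at EVERY cutoff.  File 11's
`shellWeightBound_of_globalCompact` FIRES: (FD) with `D K j = sup_t lev^X K t + 1`, (L2↓) with **`V_j = 2(∏_{σ<S}(ν_{j,σ} + 1) − 1)`** (the per-level cascade, §3),
`Z_K = 1`, realized ledgers and cover by σ-additivity; left as hypotheses exactly the WINDOW BOOKKEEPING (`n_j`, `W K` ∕ `B j`, loss factors `t_j`, window majorant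
`Σ_{j∈W K} t_j·(2·#B_j·V_j∕n_j) ≤ C·ϑ^K`).  Conclusion: ONE global `c` (`c j < n_j`) with `T4IndicatorShell.ShellWeightBound` BY NAME, `Wsh K` = the two runs'
total booked-shell mass at `c`. [folklore] -/
theorem shellWeightBound_globalAdaptiveTree (l₀ : ℝ) {C ϑ : ℝ} (n : ℕ → ℕ) (hn : ∀ j, 0 < n j) (B W : ℕ → Finset ℕ) (hWB : ∀ K j, j ∈ W K → K ∈ B j) (huA : ∀ K t, Measurable (uA K t)) (huB : ∀ K t, Measurable (uB K t)) (hθ : ∀ K t, 0 ≤ θ K t) (hs0 : ∀ j, 0 ≤ ρs j) (hs1 : ∀ j, ρs j ≤ 1) (hA0 : ∀ K t, 0 ≤ ρA K t) (hA2 : ∀ K t, 2 * ρA K t ≤ ρs (levA K t)) (hB0 : ∀ K t, 0 ≤ ρB K t) (hB2 : ∀ K t, 2 * ρB K t ≤ ρs (levB K t)) (hlevA : ∀ K t, levA K t ∈ W K) (hlevB : ∀ K t, levB K t ∈ W K)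
    (hνA : ∀ K j σ a, ((testsA K σ a).filter fun t => levA K t = j).card ≤ ν j σ)
    (hνB : ∀ K j σ a, ((testsB K σ a).filter fun t => levB K t = j).card ≤ ν j σ)
    (tl : ℕ → ℝ) (htl0 : ∀ j, 0 < tl j) (htl : ∀ J, ∑ j ∈ range J, (tl j)⁻¹ < 1) (hϑ0 : 0 ≤ ϑ) (hϑ1 : ϑ < 1)
    (hgeo : ∀ K, ∑ j ∈ W K, tl j * (2 * ((B j).card : ℝ) * (((2 * ∏ σ ∈ range S, (ν j σ + 1) - 2 : ℕ) : ℝ)) / n j) ≤ C * ϑ ^ K) :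
    ∃ c : ℕ → ℕ, (∀ j, c j < n j) ∧
      T4IndicatorShell.ShellWeightBound l₀ (fun _ => (univ : Finset (τ → Bool)))
        (fun K (_ : ℝ) (ω : τ → Bool) => (PA K).real (⋂ t, (uA K t) ⁻¹' (if ω t then Iio (θ K t * (1 - ρs (levA K t)) ^ c (levA K t)) else Ici (θ K t * (1 - ρs (levA K t)) ^ c (levA K t)))))
        (fun K (_ : ℝ) (ω : τ → Bool) => (PB K).real (⋂ t, (uB K t) ⁻¹' (if ω t then Iio (θ K t * (1 - ρs (levB K t)) ^ c (levB K t)) else Ici (θ K t * (1 - ρs (levB K t)) ^ c (levB K t)))))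
        (fun K (_ : ℝ) (ω : τ → Bool) => (PA K).real ((⋂ t, (uA K t) ⁻¹' (if ω t then Iio (θ K t * (1 - ρs (levA K t)) ^ c (levA K t)) else Ici (θ K t * (1 - ρs (levA K t)) ^ c (levA K t)))) ∩ ⋃ p : Fin S × τ, {x | p.2 ∈ testsA K p.1 (Nat.rec (motive := fun _ => α) (aA K) (fun σ a => nextA K σ a ((testsA K σ a).filter fun t => ω t = true)) p.1) ∧ uA K p.2 x ∈ twoSidedShell (θ K p.2) (ρs (levA K p.2)) (ρA K p.2) (c (levA K p.2))}))
        (fun K (_ : ℝ) (ω : τ → Bool) => (PB K).real ((⋂ t, (uB K t) ⁻¹' (if ω t then Iio (θ K t * (1 - ρs (levB K t)) ^ c (levB K t)) else Ici (θ K t * (1 - ρs (levB K t)) ^ c (levB K t)))) ∩ ⋃ p : Fin S × τ, {x | p.2 ∈ testsB K p.1 (Nat.rec (motive := fun _ => α) (aB K) (fun σ a => nextB K σ a ((testsB K σ a).filter fun t => ω t = true)) p.1) ∧ uB K p.2 x ∈ twoSidedShell (θ K p.2) (ρs (levB K p.2)) (ρB K p.2) (c (levB K p.2))}))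
        (fun K => ∑ p : Fin S × τ, ∑ ω : τ → Bool, (PA K).real ((⋂ t, (uA K t) ⁻¹' (if ω t then Iio (θ K t * (1 - ρs (levA K t)) ^ c (levA K t)) else Ici (θ K t * (1 - ρs (levA K t)) ^ c (levA K t)))) ∩ {x | p.2 ∈ testsA K p.1 (Nat.rec (motive := fun _ => α) (aA K) (fun σ a => nextA K σ a ((testsA K σ a).filter fun t => ω t = true)) p.1) ∧ uA K p.2 x ∈ twoSidedShell (θ K p.2) (ρs (levA K p.2)) (ρA K p.2) (c (levA K p.2))}) + ∑ p : Fin S × τ, ∑ ω : τ → Bool, (PB K).real ((⋂ t,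
                (uB K t) ⁻¹' (if ω t then Iio (θ K t * (1 - ρs (levB K t)) ^ c (levB K t)) else Ici (θ K t * (1 - ρs (levB K t)) ^ c (levB K t)))) ∩ {x | p.2 ∈ testsB K p.1
                (Nat.rec (motive := fun _ => α) (aB K) (fun σ a => nextB K σ a ((testsB K σ a).filter fun t => ω t = true)) p.1) ∧ uB K p.2 x ∈ twoSidedShell (θ K p.2) (ρs
                (levB K p.2)) (ρB K p.2) (c (levB K p.2))})) := by
  have h1A : ∀ (c : ℕ → ℕ) (K : ℕ), ∑ ω : τ → Bool, (PA K).real (⋂ t, (uA K t) ⁻¹' (if ω t then Iio (θ K t * (1 - ρs (levA K t)) ^ c (levA K t)) else Ici (θ K t * (1 - ρs (levA K t)) ^ c (levA K t)))) = 1 :=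
    fun c K => sum_measureReal_cellAt_eq_one (uA K) (θ K) ρs (levA K) (PA K) (huA K) c
  have h1B : ∀ (c : ℕ → ℕ) (K : ℕ), ∑ ω : τ → Bool, (PB K).real (⋂ t, (uB K t) ⁻¹' (if ω t then Iio (θ K t * (1 - ρs (levB K t)) ^ c (levB K t)) else Ici (θ K t * (1 - ρs (levB K t)) ^ c (levB K t)))) = 1 :=
    fun c K => sum_measureReal_cellAt_eq_one (uB K) (θ K) ρs (levB K) (PB K) (huB K) c
  obtain ⟨c, hc, hSWB⟩ := shellWeightBound_of_globalCompact (l₀ := l₀) (a := 0) (C := C) (ϑ := ϑ)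
    (T := fun _ => (univ : Finset (τ → Bool))) n hn B W hWB
    (A := fun c K (_ : ℝ) (ω : τ → Bool) => (PA K).real (⋂ t, (uA K t) ⁻¹' (if ω t then Iio (θ K t * (1 - ρs (levA K t)) ^ c (levA K t)) else Ici (θ K t * (1 - ρs (levA K t)) ^ c (levA K t)))))
    (A' := fun c K (_ : ℝ) (ω : τ → Bool) => (PB K).real (⋂ t, (uB K t) ⁻¹' (if ω t then Iio (θ K t * (1 - ρs (levB K t)) ^ c (levB K t)) else Ici (θ K t * (1 - ρs (levB K t)) ^ c (levB K t)))))
    (shA := fun c K (_ : ℝ) (ω : τ → Bool) => (PA K).real ((⋂ t, (uA K t) ⁻¹' (if ω t then Iio (θ K t * (1 - ρs (levA K t)) ^ c (levA K t)) else Ici (θ K t * (1 - ρs (levA K t)) ^ c (levA K t)))) ∩ ⋃ p : Fin S × τ, {x | p.2 ∈ testsA K p.1 (Nat.rec (motive := fun _ => α) (aA K) (fun σ a => nextA K σ a ((testsA K σ a).filter fun t =>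
            ω t = true)) p.1) ∧ uA K p.2 x ∈ twoSidedShell (θ K p.2) (ρs (levA K p.2)) (ρA K p.2) (c (levA K p.2))}))
    (shA' := fun c K (_ : ℝ) (ω : τ → Bool) => (PB K).real ((⋂ t, (uB K t) ⁻¹' (if ω t then Iio (θ K t * (1 - ρs (levB K t)) ^ c (levB K t)) else Ici (θ K t * (1 - ρs (levB K t)) ^ c (levB K t)))) ∩ ⋃ p : Fin S × τ, {x | p.2 ∈ testsB K p.1 (Nat.rec (motive := fun _ => α) (aB K) (fun σ a => nextB K σ a ((testsB K σ a).filter fun t =>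
            ω t = true)) p.1) ∧ uB K p.2 x ∈ twoSidedShell (θ K p.2) (ρs (levB K p.2)) (ρB K p.2) (c (levB K p.2))}))
    (SA := fun _ => (univ : Finset (Fin S × τ))) (SA' := fun _ => (univ : Finset (Fin S × τ)))
    (pieceA := fun c K (_ : ℝ) (p : Fin S × τ) (ω : τ → Bool) => (PA K).real ((⋂ t, (uA K t) ⁻¹' (if ω t then Iio (θ K t * (1 - ρs (levA K t)) ^ c (levA K t)) else Ici (θ K t * (1 - ρs (levA K t)) ^ c (levA K t)))) ∩ {x | p.2 ∈ testsA K p.1 (Nat.rec (motive := fun _ => α) (aA K) (fun σ a => nextA K σ a ((testsA K σ a).filter fun t => ω t = true)) p.1) ∧ uA K p.2 x ∈ twoSidedShell (θ K p.2) (ρs (levA K p.2)) (ρA K p.2) (c (levA K p.2))}))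
    (pieceA' := fun c K (_ : ℝ) (p : Fin S × τ) (ω : τ → Bool) => (PB K).real ((⋂ t, (uB K t) ⁻¹' (if ω t then Iio (θ K t * (1 - ρs (levB K t)) ^ c (levB K t)) else Ici (θ K t * (1 - ρs (levB K t)) ^ c (levB K t)))) ∩ {x | p.2 ∈ testsB K p.1 (Nat.rec (motive := fun _ => α) (aB K) (fun σ a => nextB K σ a ((testsB K σ a).filter fun t => ω t = true)) p.1) ∧ uB K p.2 x ∈ twoSidedShell (θ K p.2) (ρs (levB K p.2)) (ρB K p.2) (c (levB K p.2))}))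
    (fun c _ => by
      refine SlotLedger.of_realized (a := 0) ?_ ?_ ?_ ?_ ?_ ?_ ?_
      · intro K t _ ω _; exact (ledger_fields (S := S) (uA K) (θ K) (ρA K) ρs (levA K) (testsA K) (nextA K) (aA K) c (PA K) (huA K)).1 ω
      · intro K t _ ω _; exact (ledger_fields (S := S) (uA K) (θ K) (ρA K) ρs (levA K) (testsA K) (nextA K) (aA K) c (PA K) (huA K)).2.1 ω
      · intro K t _ ω _; exact (ledger_fields (S := S) (uA K) (θ K) (ρA K) ρs (levA K) (testsA K) (nextA K) (aA K) c (PA K) (huA K)).2.2.1 ω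
      · intro K s _ ω _; exact measureReal_nonneg
      · intro K; exact (ledger_fields (S := S) (uA K) (θ K) (ρA K) ρs (levA K) (testsA K) (nextA K) (aA K) c (PA K) (huA K)).2.2.2
      · intro K t _ s _; rw [Real.exp_zero, one_mul]
      · intro K t _; simp only [Real.exp_zero, one_mul, le_refl])
    (fun c _ => by
      refine SlotLedger.of_realized (a := 0) ?_ ?_ ?_ ?_ ?_ ?_ ?_
      · intro K t _ ω _; exact (ledger_fields (S := S) (uB K) (θ K) (ρB K) ρs (levB K) (testsB K) (nextB K) (aB K) c (PB K) (huB K)).1 ω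
      · intro K t _ ω _; exact (ledger_fields (S := S) (uB K) (θ K) (ρB K) ρs (levB K) (testsB K) (nextB K) (aB K) c (PB K) (huB K)).2.1 ω
      · intro K t _ ω _; exact (ledger_fields (S := S) (uB K) (θ K) (ρB K) ρs (levB K) (testsB K) (nextB K) (aB K) c (PB K) (huB K)).2.2.1 ω
      · intro K s _ ω _; exact measureReal_nonneg
      · intro K; exact (ledger_fields (S := S) (uB K) (θ K) (ρB K) ρs (levB K) (testsB K) (nextB K) (aB K) c (PB K) (huB K)).2.2.2
      · intro K t _ s _; rw [Real.exp_zero, one_mul]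
      · intro K t _; simp only [Real.exp_zero, one_mul, le_refl])
    (ZA := fun _ => 1) (ZB := fun _ => 1) (fun _ => one_pos) (fun _ => one_pos)
    (fun c _ K => (h1A c K).symm.le) (fun c _ K => (h1B c K).symm.le)
    (fun K j c => ∑ p ∈ (univ : Finset (Fin S × τ)).filter (fun p => levA K p.2 = j), ∑ ω : τ → Bool, (PA K).real ((⋂ t, (uA K t) ⁻¹' (if ω t then Iio (θ K t * (1 - ρs (levA K t)) ^ c (levA K t)) else Ici (θ K t * (1 - ρs (levA K t)) ^ c (levA K t)))) ∩ {x | p.2 ∈ testsA K p.1 (Nat.rec (motive := fun _ => α) (aA K) (fun σ a =>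
            nextA K σ a ((testsA K σ a).filter fun t => ω t = true)) p.1) ∧ uA K p.2 x ∈ twoSidedShell (θ K p.2) (ρs (levA K p.2)) (ρA K p.2) (c (levA K p.2))}))
    (fun K j c => ∑ p ∈ (univ : Finset (Fin S × τ)).filter (fun p => levB K p.2 = j), ∑ ω : τ → Bool, (PB K).real ((⋂ t, (uB K t) ⁻¹' (if ω t then Iio (θ K t * (1 - ρs (levB K t)) ^ c (levB K t)) else Ici (θ K t * (1 - ρs (levB K t)) ^ c (levB K t)))) ∩ {x | p.2 ∈ testsB K p.1 (Nat.rec (motive := fun _ => α) (aB K) (fun σ a =>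
            nextB K σ a ((testsB K σ a).filter fun t => ω t = true)) p.1) ∧ uB K p.2 x ∈ twoSidedShell (θ K p.2) (ρs (levB K p.2)) (ρB K p.2) (c (levB K p.2))}))
    (fun K j c => sum_nonneg fun p _ => sum_nonneg fun ω _ => measureReal_nonneg)
    (fun K j c => sum_nonneg fun p _ => sum_nonneg fun ω _ => measureReal_nonneg)
    (fun K j => (univ : Finset τ).sup (levA K) ⊔ (univ : Finset τ).sup (levB K) + 1)
    (fun K j c c' _ _ hcc' => by
      have hct : ∀ t, c (levA K t) = c' (levA K t) := fun t =>
        hcc' _ (Nat.lt_succ_of_le ((Finset.le_sup (Finset.mem_univ t)).trans le_sup_left))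
      simp only [hct])
    (fun K j c c' _ _ hcc' => by
      have hct : ∀ t, c (levB K t) = c' (levB K t) := fun t =>
        hcc' _ (Nat.lt_succ_of_le ((Finset.le_sup (Finset.mem_univ t)).trans le_sup_right))
      simp only [hct])
    (fun j => (((2 * ∏ σ ∈ range S, (ν j σ + 1) - 2 : ℕ) : ℝ))) (fun j => Nat.cast_nonneg _)
    (fun K j c _ => by
      rw [mul_one]
      exact levelTotal_le (uA K) (θ K) (ρA K) ρs (levA K) (testsA K) (nextA K) (aA K) c j (PA K) (huA K) (hθ K) (hA0 K)
        (fun t ht => by have := hA2 K t; rw [ht] at this; linarith [hA0 K t]) (hs0 j) (hs1 j) (ν j) (hνA K j) (n j))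
    (fun K j c _ => by
      rw [mul_one]
      exact levelTotal_le (uB K) (θ K) (ρB K) ρs (levB K) (testsB K) (nextB K) (aB K) c j (PB K) (huB K) (hθ K) (hB0 K)
        (fun t ht => by have := hB2 K t; rw [ht] at this; linarith [hB0 K t]) (hs0 j) (hs1 j) (ν j) (hνB K j) (n j))
    (fun c _ K => le_of_eq (Finset.sum_fiberwise_of_maps_to (s := (univ : Finset (Fin S × τ))) (t := W K) (g := fun p => levA K p.2)
      (fun p _ => hlevA K p.2) _).symm)
    (fun c _ K => le_of_eq (Finset.sum_fiberwise_of_maps_to (s := (univ : Finset (Fin S × τ))) (t := W K) (g := fun p => levB K p.2)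
      (fun p _ => hlevB K p.2) _).symm)
    tl htl0 htl hϑ0 hϑ1 hgeo
  refine ⟨c, hc, ?_⟩
  simp only [SlotLedger.omega, mul_zero, Real.exp_zero, one_mul, h1A, h1B, div_one] at hSWB
  exact hSWB

end Main

end Summit.QuantumFields.BalabanUV.T4Continuum.Spine.NE7c.LiveFactorGlobalAdaptiveModel

end
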